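import Literature.Analysis.Complex.HolomorphicParametricIntegral
import Mathlib.Analysis.Complex.CauchyIntegral
import Mathlib.Analysis.SpecialFunctions.Complex.LogDeriv
import Mathlib.Analysis.SpecialFunctions.Pow.Real
import Mathlib.Analysis.SpecialFunctions.Integrals.Basic
import Mathlib.MeasureTheory.Integral.IntervalIntegral.FundThmCalculus
import HarnessLib

/-!
# Arias de Reyna's kernel `f(ζ) = −log(1−ζ)/ζ² − 1/ζ − 1/2` and the function `(1−ζ)^{−σ} e^{−λ f(ζ)}`

Topic `Literature/NumberTheory/LFunctions` (namespace `Literature.NumberTheory.LFunctions.AriasDeReyna`).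
First file of the proof of Arias de Reyna's bounds for the terms and the remainder of the
Riemann–Siegel expansion (Math. Comp. 80 (2011), Thms. 3.1, 4.1, 4.2; the tree's named fact
`Literature.NumberTheory.LFunctions.arias_lehmer_rs_bound`). After the substitution `τ ↦ iζ/(2z)` of the
source (eq. (4.4)) the generating function `g(τ, z)` of the Riemann–Siegel polynomials `P_k(z)` becomes

  `(1 − ζ)^{−σ} exp(−(iz²/2) f(ζ))`,  `f(ζ) = −log(1 − ζ)/ζ² − 1/ζ − 1/2`  (eq. (4.5)),

and on the saddle-point line `−iz²/2 = −λ ≤ 0` is real. This file treats `f` and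
`G_{σ,λ}(ζ) = (1 − ζ)^{−σ} e^{−λ f(ζ)}` as holomorphic functions on the cut plane `ℂ ∖ [1, ∞)`:

* `fKer` is DEFINED by the integral `f(ζ) = ∫₀¹ x² ζ/(1 − xζ) dx` (so that `ζ = 0` is not a special
  point); `fKer_eq_log` is the closed form (4.5) for `ζ ≠ 0`, `differentiableOn_fKer` holomorphy on the
  cut plane, `norm_fKer_sub_sum_le` the tail bound of its power series `Σ_{n≥1} ζⁿ/(n+2)`;
* `re_fKer_neg_le` — the minimum property used in the proof of Thm. 4.1 (and in footnote 1 of the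
  source): on the circle `|ζ| = r ≤ 1`, `V(ζ) = Re f(ζ)` is minimal at `ζ = −r`; here it follows from the
  pointwise inequality `Re(ζ/(1 − xζ)) ≥ −r/(1 + xr)` under the integral sign;
* `gKer σ λ`, its norm `|1 − ζ|^{−σ} e^{−λ V(ζ)}` (`norm_gKer`), holomorphy, and the bound on circles
  `‖G‖ ≤ A_σ(r) e^{−λ V(−r)}` (`norm_gKer_le_of_norm_eq`) with `A_σ(r) = (1 − r)^{−σ}` for `σ > 0` and
  `(1 + r)^{−σ}` for `σ ≤ 0` (`circleConst`);
* the Taylor coefficients `qCoeff σ λ k` of `G_{σ,λ}` at `0` (Mathlib's `cauchyPowerSeries`) and the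
  Cauchy estimate `‖q_k‖ ≤ A_σ(r) e^{−λV(−r)} r^{−k}` for every `0 < r < 1` (`norm_qCoeff_le`), which is the
  content of the proof of Thm. 4.1 up to the Gaussian integral in `z`.

Everything here is proved; no named facts.

## References

* J. Arias de Reyna, *High precision computation of Riemann's zeta function by the Riemann–Siegel
  formula, I*, Math. Comp. 80 (2011), 995–1009: eqs. (3.6)–(3.7), (4.4)–(4.5), proof of Thm. 4.1,
  footnote 1 (p. 1006). [AriasDeReyna2011]
-/

noncomputable section

open Complex MeasureTheory Set Filter Metric intervalIntegral
open scoped Real Topology NNReal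

namespace Literature.NumberTheory.LFunctions

namespace AriasDeReyna

/-! ## The cut plane `ℂ ∖ [1, ∞)` -/

/-- The cut plane `ℂ ∖ [1, ∞)`, the domain of holomorphy of `f` and of `(1−ζ)^{−σ}e^{−λf(ζ)}`
(principal branches). [cite: AriasDeReyna2011, proof of Thm. 4.2 ("a cut along the real axis from 1 to +∞")] -/
def cutPlane : Set ℂ := {ζ : ℂ | ζ.im ≠ 0 ∨ ζ.re < 1}

/-- The cut plane is open. [cite: AriasDeReyna2011, proof of Thm. 4.2] -/
lemma isOpen_cutPlane : IsOpen cutPlane :=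
  (isOpen_ne_fun Complex.continuous_im continuous_const).union (isOpen_lt Complex.continuous_re continuous_const)

/-- `0` lies off the cut. [cite: AriasDeReyna2011, proof of Thm. 4.2] -/
lemma zero_mem_cutPlane : (0 : ℂ) ∈ cutPlane := Or.inr (by simp)

/-- The open unit disc lies off the cut `[1, ∞)`. [cite: AriasDeReyna2011, proof of Thm. 4.1 ("radius `r < 1`")] -/
lemma mem_cutPlane_of_norm_lt_one {ζ : ℂ} (h : ‖ζ‖ < 1) : ζ ∈ cutPlane :=
  Or.inr (lt_of_le_of_lt (Complex.re_le_norm ζ) h)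

/-- For `ζ` in the cut plane and `0 ≤ x ≤ 1`, `1 − xζ` lies in Mathlib's slit plane (off `(−∞, 0]`), so
the principal logarithm `log(1 − xζ)` is holomorphic there. [cite: AriasDeReyna2011, eq. (4.5)] -/
lemma one_sub_mul_mem_slitPlane {ζ : ℂ} (hζ : ζ ∈ cutPlane) {x : ℝ} (hx0 : 0 ≤ x) (hx1 : x ≤ 1) :
    1 - (x : ℂ) * ζ ∈ slitPlane := by
  rw [Complex.mem_slitPlane_iff]
  simp only [sub_re, one_re, mul_re, ofReal_re, ofReal_im, zero_mul, sub_zero, sub_im, one_im,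
    mul_im, add_zero, zero_sub, neg_ne_zero, mul_ne_zero_iff]
  rcases hζ with h | h
  · by_cases hx : x = 0
    · left; rw [hx]; simp
    · right; exact ⟨hx, h⟩
  · left
    have : x * ζ.re ≤ max ζ.re 0 := by
      rcases le_or_gt 0 ζ.re with h0 | h0
      · calc x * ζ.re ≤ 1 * ζ.re := mul_le_mul_of_nonneg_right hx1 h0
          _ = ζ.re := one_mul _
          _ ≤ max ζ.re 0 := le_max_left _ _
      · exact (mul_nonpos_of_nonneg_of_nonpos hx0 h0.le).trans (le_max_right _ _)
    have hmax : max ζ.re 0 < 1 := max_lt h one_pos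
    linarith

/-- `1 − xζ ≠ 0` for `ζ` off the cut and `0 ≤ x ≤ 1`. [cite: AriasDeReyna2011, eq. (4.5)] -/
lemma one_sub_mul_ne_zero {ζ : ℂ} (hζ : ζ ∈ cutPlane) {x : ℝ} (hx0 : 0 ≤ x) (hx1 : x ≤ 1) :
    1 - (x : ℂ) * ζ ≠ 0 :=
  Complex.slitPlane_ne_zero (one_sub_mul_mem_slitPlane hζ hx0 hx1)

/-- `1 − ζ` is off the negative real axis for `ζ` off the cut (principal logarithm in (4.5)). [cite: AriasDeReyna2011, eq. (4.5)] -/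
lemma one_sub_mem_slitPlane {ζ : ℂ} (hζ : ζ ∈ cutPlane) : 1 - ζ ∈ slitPlane := by
  simpa using one_sub_mul_mem_slitPlane hζ zero_le_one le_rfl

/-- `1 − ζ ≠ 0` for `ζ` off the cut. [cite: AriasDeReyna2011, eq. (4.5)] -/
lemma one_sub_ne_zero {ζ : ℂ} (hζ : ζ ∈ cutPlane) : 1 - ζ ≠ 0 :=
  Complex.slitPlane_ne_zero (one_sub_mem_slitPlane hζ)

/-! ## The kernel `f` -/

/-- The integrand `x² ζ/(1 − xζ)` of the integral representation of `f`. [cite: AriasDeReyna2011, eq. (4.5)] -/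
def fIntegrand (ζ : ℂ) (x : ℝ) : ℂ := (x : ℂ) ^ 2 * ζ / (1 - (x : ℂ) * ζ)

/-- Arias de Reyna's `f(ζ) = −log(1 − ζ)/ζ² − 1/ζ − 1/2 = Σ_{n≥1} ζⁿ/(n+2)`, DEFINED as
`∫₀¹ x² ζ/(1 − xζ) dx` (equal to the closed form for `ζ ≠ 0` off the cut, `fKer_eq_log`).
[cite: AriasDeReyna2011, eq. (4.5)] -/
def fKer (ζ : ℂ) : ℂ := ∫ x in (0:ℝ)..1, fIntegrand ζ x

/-- Continuity of the integrand of `f` on `[0, 1]`. [cite: AriasDeReyna2011, eq. (4.5)] -/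
lemma continuousOn_fIntegrand {ζ : ℂ} (hζ : ζ ∈ cutPlane) : ContinuousOn (fIntegrand ζ) (Icc 0 1) := by
  refine ContinuousOn.div (by fun_prop) (by fun_prop) fun x hx ↦ one_sub_mul_ne_zero hζ hx.1 hx.2

/-- Integrability of the integrand of `f` on `[0, 1]`. [cite: AriasDeReyna2011, eq. (4.5)] -/
lemma intervalIntegrable_fIntegrand {ζ : ℂ} (hζ : ζ ∈ cutPlane) :
    IntervalIntegrable (fIntegrand ζ) volume 0 1 :=
  (continuousOn_fIntegrand hζ).intervalIntegrable_of_Icc zero_le_one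

/-- `f(0) = 0`. [cite: AriasDeReyna2011, eq. (4.5)] -/
lemma fKer_zero : fKer 0 = 0 := by simp [fKer, fIntegrand]

/-- **The closed form (4.5)**: for `ζ ≠ 0` off the cut `[1, ∞)`,
`f(ζ) = −log(1 − ζ)/ζ² − 1/ζ − 1/2`. [cite: AriasDeReyna2011, eq. (4.5)] -/
theorem fKer_eq_log {ζ : ℂ} (hζ : ζ ∈ cutPlane) (hζ0 : ζ ≠ 0) :
    fKer ζ = -Complex.log (1 - ζ) / ζ ^ 2 - 1 / ζ - 1 / 2 := by
  -- antiderivative `Φ(x) = −log(1 − xζ)/ζ² − x/ζ − x²/2`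
  have hderiv : ∀ x ∈ uIcc (0:ℝ) 1,
      HasDerivAt (fun y : ℝ ↦ -Complex.log (1 - (y : ℂ) * ζ) / ζ ^ 2 - (y : ℂ) / ζ - (y : ℂ) ^ 2 / 2)
        (fIntegrand ζ x) x := by
    intro x hx
    rw [uIcc_of_le zero_le_one] at hx
    have hslit := one_sub_mul_mem_slitPlane hζ hx.1 hx.2
    have hne := one_sub_mul_ne_zero hζ hx.1 hx.2
    have h1 : HasDerivAt (fun z : ℂ ↦ 1 - z * ζ) (-ζ) (x : ℂ) := by
      simpa using ((hasDerivAt_id (x : ℂ)).mul_const ζ).const_sub 1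
    have h2 : HasDerivAt (fun z : ℂ ↦ Complex.log (1 - z * ζ)) (-ζ / (1 - (x : ℂ) * ζ)) (x : ℂ) :=
      h1.clog hslit
    have h3 : HasDerivAt (fun z : ℂ ↦ -Complex.log (1 - z * ζ) / ζ ^ 2 - z / ζ - z ^ 2 / 2)
        (-(-ζ / (1 - (x : ℂ) * ζ)) / ζ ^ 2 - 1 / ζ - ((2 : ℕ) : ℂ) * (x : ℂ) ^ (2 - 1) / 2) (x : ℂ) :=
      ((h2.neg.div_const (ζ ^ 2)).sub ((hasDerivAt_id' (x : ℂ)).div_const ζ)).sub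
        ((hasDerivAt_pow 2 (x : ℂ)).div_const 2)
    have h4 : -(-ζ / (1 - (x : ℂ) * ζ)) / ζ ^ 2 - 1 / ζ - ((2 : ℕ) : ℂ) * (x : ℂ) ^ (2 - 1) / 2 =
        fIntegrand ζ x := by
      have hne' : (1 : ℂ) - ζ * (x : ℂ) ≠ 0 := by rwa [mul_comm] at hne
      rw [fIntegrand]
      field_simp
      ring
    exact (h3.congr_deriv h4).comp_ofReal
  have hint : IntervalIntegrable (fIntegrand ζ) volume 0 1 := intervalIntegrable_fIntegrand hζ
  rw [fKer, integral_eq_sub_of_hasDerivAt hderiv hint]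
  simp

/-! ## Holomorphy of `f` on the cut plane -/

/-- A uniform lower bound for `|1 − xζ|` near a point of the cut plane. [folklore] -/
private lemma exists_ball_norm_one_sub_mul_ge {ζ₀ : ℂ} (hζ₀ : ζ₀ ∈ cutPlane) :
    ∃ ρ δ : ℝ, 0 < ρ ∧ 0 < δ ∧ closedBall ζ₀ ρ ⊆ cutPlane ∧
      ∀ ζ ∈ closedBall ζ₀ ρ, ∀ x ∈ Icc (0:ℝ) 1, δ ≤ ‖1 - (x : ℂ) * ζ‖ := by
  obtain ⟨ρ₀, hρ₀, hball⟩ := Metric.isOpen_iff.1 isOpen_cutPlane ζ₀ hζ₀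
  set ρ := ρ₀ / 2 with hρ
  have hρpos : 0 < ρ := by positivity
  have hsub : closedBall ζ₀ ρ ⊆ cutPlane := (closedBall_subset_ball (by linarith)).trans hball
  -- the continuous positive function `(ζ, x) ↦ |1 − xζ|` on the compact set `closedBall × [0,1]`
  have hK : IsCompact (closedBall ζ₀ ρ ×ˢ Icc (0:ℝ) 1) := (isCompact_closedBall _ _).prod isCompact_Icc
  have hcont : ContinuousOn (fun p : ℂ × ℝ ↦ ‖1 - (p.2 : ℂ) * p.1‖) (closedBall ζ₀ ρ ×ˢ Icc (0:ℝ) 1) := by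
    fun_prop
  have hne : (closedBall ζ₀ ρ ×ˢ Icc (0:ℝ) 1).Nonempty :=
    ⟨(ζ₀, 0), mem_closedBall_self hρpos.le, left_mem_Icc.2 zero_le_one⟩
  obtain ⟨p₀, hp₀, hmin⟩ := hK.exists_isMinOn hne hcont
  refine ⟨ρ, ‖1 - (p₀.2 : ℂ) * p₀.1‖, hρpos, ?_, hsub, fun ζ hζ x hx ↦ hmin (mk_mem_prod hζ hx)⟩
  rw [mem_prod] at hp₀
  exact norm_pos_iff.2 (one_sub_mul_ne_zero (hsub hp₀.1) hp₀.2.1 hp₀.2.2)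

/-- **`f` is holomorphic on the cut plane `ℂ ∖ [1, ∞)`** (including `ζ = 0`).
[cite: AriasDeReyna2011, proof of Thm. 4.1 ("`g(τ, z)` is an analytic function of `τ`")] -/
theorem differentiableOn_fKer : DifferentiableOn ℂ fKer cutPlane := by
  have key : DifferentiableOn ℂ (fun ζ ↦ ∫ x in Ioc (0:ℝ) 1, fIntegrand ζ x) cutPlane := by
    refine Literature.Analysis.Complex.differentiableOn_integral_of_dominated
      (μ := volume.restrict (Ioc (0:ℝ) 1)) (F := fun ζ x ↦ fIntegrand ζ x) ?_ ?_ ?_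
    · intro ζ hζ
      exact ((continuousOn_fIntegrand hζ).mono Ioc_subset_Icc_self).aestronglyMeasurable measurableSet_Ioc
    · refine (ae_restrict_iff' measurableSet_Ioc).2 (Eventually.of_forall fun x hx ↦ ?_)
      intro ζ hζ
      have hne := one_sub_mul_ne_zero hζ hx.1.le hx.2
      have h1 : DifferentiableAt ℂ (fun ζ : ℂ ↦ (x : ℂ) ^ 2 * ζ) ζ := by fun_prop
      have h2 : DifferentiableAt ℂ (fun ζ : ℂ ↦ 1 - (x : ℂ) * ζ) ζ := by fun_prop
      exact (h1.div h2 hne).differentiableWithinAt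
    · intro ζ₀ hζ₀
      obtain ⟨ρ, δ, hρ, hδ, hsub, hlow⟩ := exists_ball_norm_one_sub_mul_ge hζ₀
      refine ⟨ρ, hρ, (ball_subset_closedBall).trans hsub, fun _ ↦ (‖ζ₀‖ + ρ) / δ, ?_, ?_⟩
      · exact integrableOn_const (by simp)
      · refine (ae_restrict_iff' measurableSet_Ioc).2 (Eventually.of_forall fun x hx ζ hζ ↦ ?_)
        have hζ' : ζ ∈ closedBall ζ₀ ρ := ball_subset_closedBall hζ
        have h1 : δ ≤ ‖1 - (x : ℂ) * ζ‖ := hlow ζ hζ' x ⟨hx.1.le, hx.2⟩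
        have h2 : ‖ζ‖ ≤ ‖ζ₀‖ + ρ := by
          have := mem_closedBall.1 hζ'
          rw [dist_eq_norm] at this
          linarith [norm_le_norm_add_norm_sub' ζ ζ₀, norm_sub_rev ζ ζ₀]
        rw [fIntegrand, norm_div, norm_mul, norm_pow, Complex.norm_real, Real.norm_eq_abs,
          abs_of_nonneg hx.1.le]
        rw [div_le_div_iff₀ (lt_of_lt_of_le hδ h1) hδ]
        have hx2 : x ^ 2 ≤ 1 := by nlinarith [hx.1, hx.2]
        calc x ^ 2 * ‖ζ‖ * δ ≤ 1 * (‖ζ₀‖ + ρ) * ‖1 - (x : ℂ) * ζ‖ := by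
              gcongr
          _ = (‖ζ₀‖ + ρ) * ‖1 - (x : ℂ) * ζ‖ := by ring
  refine key.congr fun ζ hζ ↦ ?_
  rw [fKer, intervalIntegral.integral_of_le zero_le_one]

/-- `f` is continuous on the cut plane. [cite: AriasDeReyna2011, eq. (4.5)] -/
lemma continuousOn_fKer : ContinuousOn fKer cutPlane := differentiableOn_fKer.continuousOn

/-! ## The power series `Σ ζⁿ/(n+2)` of `f`: tail bound -/

/-- A finite geometric sum: `Σ_{n<N} x^{n+2}ζ^{n+1}(1 − xζ) = x²ζ − x^{N+2}ζ^{N+1}`. [folklore] -/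
private lemma geom_aux (x ζ : ℂ) (N : ℕ) :
    ∑ n ∈ Finset.range N, x ^ (n + 2) * ζ ^ (n + 1) * (1 - x * ζ) = x ^ 2 * ζ - x ^ (N + 2) * ζ ^ (N + 1) := by
  induction N with
  | zero => simp
  | succ m ih => rw [Finset.sum_range_succ, ih]; ring

/-- For `|ζ| < 1` and `N ≥ 0`: `|f(ζ) − Σ_{n=1}^{N} ζⁿ/(n+2)| ≤ |ζ|^{N+1}/((N+3)(1 − |ζ|))`
(`f(ζ) = Σ_{n ≥ 1} ζⁿ/(n+2) = ζ/3 − ζ²/4 + …` of the source, eq. (4.5) expanded). [cite: AriasDeReyna2011, eq. (4.5)] -/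
theorem norm_fKer_sub_sum_le {ζ : ℂ} (hζ : ‖ζ‖ < 1) (N : ℕ) :
    ‖fKer ζ - ∑ n ∈ Finset.range N, ζ ^ (n + 1) / ((n : ℂ) + 3)‖ ≤
      ‖ζ‖ ^ (N + 1) / (((N : ℝ) + 3) * (1 - ‖ζ‖)) := by
  have hζD : ζ ∈ cutPlane := mem_cutPlane_of_norm_lt_one hζ
  -- the partial sum as an integral: `ζ^{n+1}/(n+3) = ∫₀¹ x^{n+2} ζ^{n+1} dx`
  have hterm : ∀ n : ℕ, ζ ^ (n + 1) / ((n : ℂ) + 3) = ∫ x in (0:ℝ)..1, (x : ℂ) ^ (n + 2) * ζ ^ (n + 1) := by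
    intro n
    rw [intervalIntegral.integral_mul_const]
    have e : (fun x : ℝ ↦ (x : ℂ) ^ (n + 2)) = fun x : ℝ ↦ ((x ^ (n + 2) : ℝ) : ℂ) := by
      funext x; push_cast; rfl
    have hreal : (∫ x in (0:ℝ)..1, x ^ (n + 2)) = 1 / ((n : ℝ) + 3) := by
      rw [integral_pow]
      push_cast
      ring
    have : (∫ x in (0:ℝ)..1, (x : ℂ) ^ (n + 2)) = 1 / ((n : ℂ) + 3) := by
      rw [e, intervalIntegral.integral_ofReal, hreal]
      push_cast
      ring
    have hn : ((n : ℂ) + 3) ≠ 0 := by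
      have : ((n : ℂ) + 3) = ((n + 3 : ℕ) : ℂ) := by push_cast; ring
      rw [this]; exact Nat.cast_ne_zero.2 (by omega)
    rw [this]
    field_simp
  -- the integrand of the difference
  have hgeom : ∀ x : ℝ, 0 ≤ x → x ≤ 1 →
      fIntegrand ζ x - ∑ n ∈ Finset.range N, (x : ℂ) ^ (n + 2) * ζ ^ (n + 1) =
        (x : ℂ) ^ (N + 2) * ζ ^ (N + 1) / (1 - (x : ℂ) * ζ) := by
    intro x hx0 hx1
    have hne := one_sub_mul_ne_zero hζD hx0 hx1
    rw [fIntegrand, eq_div_iff hne, sub_mul, div_mul_cancel₀ _ hne, Finset.sum_mul, geom_aux]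
    ring
  set R : ℝ → ℂ := fun x ↦ (x : ℂ) ^ (N + 2) * ζ ^ (N + 1) / (1 - (x : ℂ) * ζ) with hR
  have hdiff : fKer ζ - ∑ n ∈ Finset.range N, ζ ^ (n + 1) / ((n : ℂ) + 3) = ∫ x in (0:ℝ)..1, R x := by
    rw [fKer]
    simp_rw [hterm]
    rw [← intervalIntegral.integral_finsetSum (f := fun n (x : ℝ) ↦ (x : ℂ) ^ (n + 2) * ζ ^ (n + 1))
      (fun n _ ↦ (by fun_prop : Continuous fun x : ℝ ↦ (x : ℂ) ^ (n + 2) * ζ ^ (n + 1)).intervalIntegrable _ _),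
      ← intervalIntegral.integral_sub (intervalIntegrable_fIntegrand hζD)
        ((continuous_finsetSum _ fun n _ ↦ by fun_prop).intervalIntegrable _ _)]
    refine intervalIntegral.integral_congr fun x hx ↦ ?_
    rw [uIcc_of_le zero_le_one] at hx
    exact hgeom x hx.1 hx.2
  rw [hdiff]
  -- bound the integrand
  have hbound : ∀ x ∈ Icc (0:ℝ) 1, ‖R x‖ ≤ x ^ (N + 2) * (‖ζ‖ ^ (N + 1) / (1 - ‖ζ‖)) := by
    intro x hx
    have h1 : 1 - ‖ζ‖ ≤ ‖1 - (x : ℂ) * ζ‖ := by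
      have h3 := norm_sub_norm_le (1 : ℂ) ((x : ℂ) * ζ)
      have h2 : ‖(x : ℂ) * ζ‖ ≤ ‖ζ‖ := by
        rw [norm_mul, Complex.norm_real, Real.norm_eq_abs, abs_of_nonneg hx.1]
        exact mul_le_of_le_one_left (norm_nonneg _) hx.2
      rw [norm_one] at h3
      linarith
    rw [hR]
    simp only
    rw [norm_div, norm_mul, norm_pow, norm_pow, Complex.norm_real, Real.norm_eq_abs, abs_of_nonneg hx.1,
      mul_div_assoc]
    exact mul_le_mul_of_nonneg_left (div_le_div_of_nonneg_left (by positivity) (by linarith) h1)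
      (pow_nonneg hx.1 _)
  calc ‖∫ x in (0:ℝ)..1, R x‖ ≤ ∫ x in (0:ℝ)..1, x ^ (N + 2) * (‖ζ‖ ^ (N + 1) / (1 - ‖ζ‖)) := by
        refine intervalIntegral.norm_integral_le_of_norm_le zero_le_one ?_ ?_
        · exact Eventually.of_forall fun x hx ↦ hbound x ⟨hx.1.le, hx.2⟩
        · exact (by fun_prop : Continuous fun x : ℝ ↦ x ^ (N + 2) * (‖ζ‖ ^ (N + 1) / (1 - ‖ζ‖))).intervalIntegrable _ _
    _ = ‖ζ‖ ^ (N + 1) / (((N : ℝ) + 3) * (1 - ‖ζ‖)) := by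
        rw [intervalIntegral.integral_mul_const, integral_pow]
        have : ((N : ℝ) + 2 + 1) = (N : ℝ) + 3 := by ring
        simp only [one_pow, zero_pow (Nat.succ_ne_zero _), sub_zero, Nat.cast_add, Nat.cast_ofNat, this]
        have hN : (0 : ℝ) < (N : ℝ) + 3 := by positivity
        field_simp

/-! ## `V = Re f`: the integral of a real kernel, and the minimum on circles -/

/-- `Re(x²ζ/(1 − xζ)) ≥ −x² r/(1 + xr)` when `|ζ| = r` and `0 ≤ x`, `xr < 1`: the pointwise inequality
behind the minimality of `V(re^{iθ})` at `θ = π`. [cite: AriasDeReyna2011, footnote 1 (p. 1006)] -/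
lemma re_fIntegrand_neg_le {ζ : ℂ} {r x : ℝ} (hr : ‖ζ‖ = r) (hx0 : 0 ≤ x) (hxr : x * r < 1) :
    (fIntegrand (-r) x).re ≤ (fIntegrand ζ x).re := by
  have hr0 : 0 ≤ r := hr ▸ norm_nonneg ζ
  have hxr' : 0 < 1 + x * r := by nlinarith
  -- left side: the real number `−x² r/(1 + xr)`
  have hL : (fIntegrand (-r) x).re = -(x ^ 2 * r / (1 + x * r)) := by
    rw [fIntegrand]
    have : (1 : ℂ) - (x : ℂ) * (-(r : ℂ)) = ((1 + x * r : ℝ) : ℂ) := by push_cast; ring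
    rw [this, show (x : ℂ) ^ 2 * (-(r : ℂ)) = ((-(x ^ 2 * r) : ℝ) : ℂ) by push_cast; ring,
      ← Complex.ofReal_div, Complex.ofReal_re]
    ring
  -- right side: `x² (Re ζ − x|ζ|²)/|1 − xζ|²`
  set D : ℂ := 1 - (x : ℂ) * ζ with hD
  have hDne : D ≠ 0 := by
    intro h0
    have : ‖(x : ℂ) * ζ‖ = 1 := by
      have : (x : ℂ) * ζ = 1 := by rw [hD] at h0; linear_combination -h0
      rw [this, norm_one]
    rw [norm_mul, Complex.norm_real, Real.norm_eq_abs, abs_of_nonneg hx0, hr] at this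
    linarith
  have hDsq : 0 < Complex.normSq D := Complex.normSq_pos.2 hDne
  have hR : (fIntegrand ζ x).re = x ^ 2 * (ζ.re - x * r ^ 2) / Complex.normSq D := by
    rw [fIntegrand, ← hD, Complex.div_re]
    have hre : D.re = 1 - x * ζ.re := by simp [hD]
    have him : D.im = -(x * ζ.im) := by simp [hD]
    have hx2re : ((x : ℂ) ^ 2 * ζ).re = x ^ 2 * ζ.re := by simp [sq]
    have hx2im : ((x : ℂ) ^ 2 * ζ).im = x ^ 2 * ζ.im := by simp [sq]
    have hr2 : ζ.re ^ 2 + ζ.im ^ 2 = r ^ 2 := by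
      rw [← hr, Complex.sq_norm, Complex.normSq_apply]; ring
    rw [hx2re, hx2im, hre, him, ← add_div]
    congr 1
    linear_combination (-(x ^ 3)) * hr2
  -- `normSq D = 1 − 2x Re ζ + x² r²`
  have hnD : Complex.normSq D = 1 - 2 * x * ζ.re + x ^ 2 * r ^ 2 := by
    have hr2 : ζ.re ^ 2 + ζ.im ^ 2 = r ^ 2 := by
      rw [← hr, Complex.sq_norm, Complex.normSq_apply]; ring
    have hre : D.re = 1 - x * ζ.re := by simp [hD]
    have him : D.im = -(x * ζ.im) := by simp [hD]
    rw [Complex.normSq_apply, hre, him]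
    linear_combination (x ^ 2) * hr2
  -- the inequality `(Re ζ + r)(1 − xr) ≥ 0`
  have hre : -r ≤ ζ.re := by
    have := Complex.abs_re_le_norm ζ
    rw [hr] at this
    linarith [neg_abs_le ζ.re]
  have key : 0 ≤ x ^ 2 * ((ζ.re + r) * (1 - x * r)) := by
    apply mul_nonneg (sq_nonneg _)
    exact mul_nonneg (by linarith) (by linarith)
  have hsum : 0 ≤ x ^ 2 * (ζ.re - x * r ^ 2) / Complex.normSq D + x ^ 2 * r / (1 + x * r) := by
    rw [div_add_div _ _ hDsq.ne' hxr'.ne', hnD]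
    apply div_nonneg
    · have e : x ^ 2 * (ζ.re - x * r ^ 2) * (1 + x * r) + (1 - 2 * x * ζ.re + x ^ 2 * r ^ 2) * (x ^ 2 * r)
          = x ^ 2 * ((ζ.re + r) * (1 - x * r)) := by ring
      rw [e]; exact key
    · rw [← hnD]; positivity
  rw [hL, hR]
  linarith

/-- `V(ζ) = Re f(ζ) = ∫₀¹ Re(x²ζ/(1 − xζ)) dx`. [cite: AriasDeReyna2011, eq. (4.5)] -/
lemma re_fKer_eq_integral {ζ : ℂ} (hζ : ζ ∈ cutPlane) :
    (fKer ζ).re = ∫ x in (0:ℝ)..1, (fIntegrand ζ x).re := by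
  rw [fKer]
  have := Complex.reCLM.intervalIntegral_comp_comm (intervalIntegrable_fIntegrand hζ)
  simpa using this.symm

/-- The value at `ζ = −r`: `f(−r) = −log(1 + r)/r² + 1/r − 1/2` (`0 < r`). [cite: AriasDeReyna2011, eq. (4.5)] -/
lemma fKer_neg_real {r : ℝ} (hr : 0 < r) :
    fKer (-r) = ((-Real.log (1 + r) / r ^ 2 + 1 / r - 1 / 2 : ℝ) : ℂ) := by
  have hD : (-(r : ℂ)) ∈ cutPlane := Or.inr (by simp; linarith)
  rw [fKer_eq_log hD (by simp [hr.ne'])]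
  have : (1 : ℂ) - -(r : ℂ) = ((1 + r : ℝ) : ℂ) := by push_cast; ring
  rw [this, ← Complex.ofReal_log (by linarith)]
  push_cast
  ring

/-- **Minimality of `V` on circles at the negative real point** (used with `r → 1` for `σ ≤ 0` and
`r = 8/9` for `σ > 0` in the proof of Thm. 4.1): for `|ζ| = r < 1`, `Re f(−r) ≤ Re f(ζ)`.
[cite: AriasDeReyna2011, footnote 1 (p. 1006) and proof of Thm. 4.1] -/
theorem re_fKer_neg_le {ζ : ℂ} {r : ℝ} (hr : ‖ζ‖ = r) (hr1 : r < 1) :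
    (fKer (-r)).re ≤ (fKer ζ).re := by
  have hr0 : 0 ≤ r := hr ▸ norm_nonneg ζ
  have hζD : ζ ∈ cutPlane := mem_cutPlane_of_norm_lt_one (hr ▸ hr1)
  have hrD : (-(r : ℂ)) ∈ cutPlane := mem_cutPlane_of_norm_lt_one (by simpa [abs_of_nonneg hr0] using hr1)
  rw [re_fKer_eq_integral hζD, re_fKer_eq_integral hrD]
  refine intervalIntegral.integral_mono_on zero_le_one ?_ ?_ fun x hx ↦ ?_
  · exact ((Complex.continuous_re.comp_continuousOn (continuousOn_fIntegrand hrD))).intervalIntegrable_of_Icc zero_le_one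
  · exact ((Complex.continuous_re.comp_continuousOn (continuousOn_fIntegrand hζD))).intervalIntegrable_of_Icc zero_le_one
  · exact re_fIntegrand_neg_le hr hx.1 (by nlinarith [hx.2])

/-! ## The function `G_{σ,λ}(ζ) = (1 − ζ)^{−σ} e^{−λ f(ζ)}` -/

/-- `G_{σ,λ}(ζ) = exp(−σ log(1 − ζ) − λ f(ζ)) = (1 − ζ)^{−σ} e^{−λ f(ζ)}`: the generating function
`g(τ, z)` of the Riemann–Siegel polynomials after the substitution `τ = iζ/(2z)`, with `λ = iz²/2`
(real and `≥ 0` on the saddle-point line). [cite: AriasDeReyna2011, eqs. (3.6), (4.4)–(4.5)] -/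
def gKer (σ lam : ℝ) (ζ : ℂ) : ℂ := cexp (-σ * Complex.log (1 - ζ) - lam * fKer ζ)

/-- `G_{σ,λ}(0) = 1` (`g(0, z) = 1`, `P₀ = 1`). [cite: AriasDeReyna2011, eq. (3.7) and §5 ("`P₀(x) = 1`")] -/
lemma gKer_zero (σ lam : ℝ) : gKer σ lam 0 = 1 := by simp [gKer, fKer_zero]

/-- `|G_{σ,λ}(ζ)| = |1 − ζ|^{−σ} e^{−λ V(ζ)}` off the cut. [cite: AriasDeReyna2011, proof of Thm. 4.1] -/
theorem norm_gKer {σ lam : ℝ} {ζ : ℂ} (hζ : ζ ∈ cutPlane) :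
    ‖gKer σ lam ζ‖ = ‖1 - ζ‖ ^ (-σ) * Real.exp (-lam * (fKer ζ).re) := by
  have hpos : 0 < ‖1 - ζ‖ := norm_pos_iff.2 (one_sub_ne_zero hζ)
  rw [gKer, Complex.norm_exp, Real.rpow_def_of_pos hpos, ← Real.exp_add]
  congr 1
  have h1 : ((-(σ : ℂ)) * Complex.log (1 - ζ)).re = -σ * Real.log ‖1 - ζ‖ := by
    rw [neg_mul, Complex.neg_re, Complex.re_ofReal_mul, Complex.log_re]; ring
  have h2 : ((lam : ℂ) * fKer ζ).re = lam * (fKer ζ).re := Complex.re_ofReal_mul _ _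
  rw [Complex.sub_re, h1, h2]
  ring

/-- `G_{σ,λ}` is holomorphic on the cut plane. [cite: AriasDeReyna2011, proof of Thm. 4.1] -/
theorem differentiableOn_gKer (σ lam : ℝ) : DifferentiableOn ℂ (gKer σ lam) cutPlane := by
  refine DifferentiableOn.cexp (DifferentiableOn.sub ?_ (differentiableOn_fKer.const_mul _))
  refine DifferentiableOn.const_mul (fun ζ hζ ↦ ?_) _
  exact ((Complex.differentiableAt_log (one_sub_mem_slitPlane hζ)).comp ζ
    ((differentiableAt_const _).sub differentiableAt_id)).differentiableWithinAt

/-- `G_{σ,λ}` is continuous on the cut plane. [cite: AriasDeReyna2011, proof of Thm. 4.1] -/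
lemma continuousOn_gKer (σ lam : ℝ) : ContinuousOn (gKer σ lam) cutPlane :=
  (differentiableOn_gKer σ lam).continuousOn

/-- The constant `A_σ(r)` bounding `|1 − ζ|^{−σ}` on the circle `|ζ| = r < 1`: `(1 − r)^{−σ}` for
`σ > 0` and `(1 + r)^{−σ}` for `σ ≤ 0`. [cite: AriasDeReyna2011, proof of Thm. 4.1] -/
def circleConst (σ r : ℝ) : ℝ := if 0 < σ then (1 - r) ^ (-σ) else (1 + r) ^ (-σ)

/-- `A_σ(r) > 0` for `0 ≤ r < 1`. [cite: AriasDeReyna2011, proof of Thm. 4.1] -/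
lemma circleConst_pos {σ r : ℝ} (hr0 : 0 ≤ r) (hr1 : r < 1) : 0 < circleConst σ r := by
  unfold circleConst
  split_ifs
  · exact Real.rpow_pos_of_pos (by linarith) _
  · exact Real.rpow_pos_of_pos (by linarith) _

/-! ## Bounds on the circles `|ζ| = r < 1` -/

/-- On `|ζ| = r < 1`: `|1 − ζ|^{−σ} ≤ A_σ(r)` (`1 − r ≤ |1 − ζ| ≤ 1 + r`).
[cite: AriasDeReyna2011, proof of Thm. 4.1] -/
lemma rpow_norm_one_sub_le {σ r : ℝ} {ζ : ℂ} (hr : ‖ζ‖ = r) (hr1 : r < 1) :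
    ‖1 - ζ‖ ^ (-σ) ≤ circleConst σ r := by
  have hlo : 1 - r ≤ ‖1 - ζ‖ := by
    have := norm_sub_norm_le (1 : ℂ) ζ
    rw [norm_one, hr] at this
    exact this
  have hhi : ‖1 - ζ‖ ≤ 1 + r := by
    have := norm_sub_le (1 : ℂ) ζ
    rw [norm_one, hr] at this
    exact this
  unfold circleConst
  split_ifs with hσ
  · exact Real.rpow_le_rpow_of_nonpos (by linarith) hlo (by linarith)
  · exact Real.rpow_le_rpow (norm_nonneg _) hhi (by linarith)

/-- **Bound of `G_{σ,λ}` on the circle `|ζ| = r < 1`** (`λ ≥ 0`): `|G(ζ)| ≤ A_σ(r) e^{−λ V(−r)}`.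
[cite: AriasDeReyna2011, proof of Thm. 4.1] -/
theorem norm_gKer_le_of_norm_eq {σ lam r : ℝ} {ζ : ℂ} (hr : ‖ζ‖ = r) (hr1 : r < 1) (hlam : 0 ≤ lam) :
    ‖gKer σ lam ζ‖ ≤ circleConst σ r * Real.exp (-lam * (fKer (-r)).re) := by
  rw [norm_gKer (mem_cutPlane_of_norm_lt_one (hr ▸ hr1))]
  refine mul_le_mul (rpow_norm_one_sub_le hr hr1) ?_ (Real.exp_pos _).le
    (circleConst_pos (hr ▸ norm_nonneg ζ) hr1).le
  rw [Real.exp_le_exp]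
  have := re_fKer_neg_le hr hr1
  nlinarith

/-! ## Taylor coefficients of `G_{σ,λ}` at `0` and the Cauchy estimate -/

/-- The Taylor coefficients `q_k(σ, λ)` of `G_{σ,λ}` at `ζ = 0` (so `P_k(z) = (−2iz)^k q_k`): Cauchy's
formula on the circle of radius `1/2` (any radius in `(0,1)` gives the same numbers,
`qCoeff_eq_circleIntegral`). [cite: AriasDeReyna2011, eq. (4.4)] -/
def qCoeff (σ lam : ℝ) (k : ℕ) : ℂ := (cauchyPowerSeries (gKer σ lam) 0 (1 / 2)).coeff k

/-- Closed discs `|ζ| ≤ r < 1` lie off the cut. [cite: AriasDeReyna2011, proof of Thm. 4.1] -/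
lemma closedBall_subset_cutPlane {r : ℝ} (hr1 : r < 1) : closedBall (0 : ℂ) r ⊆ cutPlane := fun ζ hζ ↦
  mem_cutPlane_of_norm_lt_one (lt_of_le_of_lt (by simpa using hζ) hr1)

/-- `G_{σ,λ}` is the sum of its Taylor series on every disc `|ζ| < r`, `r < 1`.
[cite: AriasDeReyna2011, eq. (3.7)] -/
theorem hasFPowerSeriesOnBall_gKer (σ lam : ℝ) {r : ℝ} (hr0 : 0 < r) (hr1 : r < 1) :
    HasFPowerSeriesOnBall (gKer σ lam) (cauchyPowerSeries (gKer σ lam) 0 r) 0 (Real.toNNReal r) := by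
  have hsub : closedBall (0 : ℂ) ((Real.toNNReal r : ℝ≥0) : ℝ) ⊆ cutPlane := by
    rw [Real.coe_toNNReal _ hr0.le]; exact closedBall_subset_cutPlane hr1
  have h := ((differentiableOn_gKer σ lam).mono hsub).hasFPowerSeriesOnBall (by simpa using hr0)
  simpa [Real.coe_toNNReal _ hr0.le] using h

/-- Independence of the radius in Cauchy's formula for the Taylor coefficients ("`C` is a circle with
center at `ζ = 0` and radius `r < 1`", any `r`). [cite: AriasDeReyna2011, proof of Thm. 4.1] -/
lemma cauchyPowerSeries_gKer_eq (σ lam : ℝ) {r : ℝ} (hr0 : 0 < r) (hr1 : r < 1) :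
    cauchyPowerSeries (gKer σ lam) 0 r = cauchyPowerSeries (gKer σ lam) 0 (1 / 2) :=
  (hasFPowerSeriesOnBall_gKer σ lam hr0 hr1).hasFPowerSeriesAt.eq_formalMultilinearSeries
    (hasFPowerSeriesOnBall_gKer σ lam (by norm_num) (by norm_num)).hasFPowerSeriesAt

/-- `q_k = (2πi)^{−1} ∮_{|ζ|=r} G(ζ) ζ^{−k−1} dζ` for every `0 < r < 1`. [cite: AriasDeReyna2011, eq. (4.4)] -/
theorem qCoeff_eq_circleIntegral (σ lam : ℝ) (k : ℕ) {r : ℝ} (hr0 : 0 < r) (hr1 : r < 1) :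
    qCoeff σ lam k = (2 * π * I : ℂ)⁻¹ • ∮ z in C(0, r), (1 / (z - 0)) ^ k • (z - 0)⁻¹ • gKer σ lam z := by
  rw [qCoeff, ← cauchyPowerSeries_gKer_eq σ lam hr0 hr1, FormalMultilinearSeries.coeff]
  have := cauchyPowerSeries_apply (gKer σ lam) 0 r k 1
  simpa using this

/-- **Cauchy's estimate for the Taylor coefficients** (the core of the proof of Thm. 4.1): for
`0 < r < 1` and `λ ≥ 0`, `|q_k(σ, λ)| ≤ A_σ(r) e^{−λ V(−r)} r^{−k}`. [cite: AriasDeReyna2011, proof of Thm. 4.1] -/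
theorem norm_qCoeff_le {σ lam r : ℝ} (hr0 : 0 < r) (hr1 : r < 1) (hlam : 0 ≤ lam) (k : ℕ) :
    ‖qCoeff σ lam k‖ ≤ circleConst σ r * Real.exp (-lam * (fKer (-r)).re) / r ^ k := by
  set M : ℝ := circleConst σ r * Real.exp (-lam * (fKer (-r)).re) with hM
  have hM0 : 0 ≤ M := mul_nonneg (circleConst_pos hr0.le hr1).le (Real.exp_pos _).le
  rw [qCoeff_eq_circleIntegral σ lam k hr0 hr1]
  have hbd : ∀ z ∈ sphere (0 : ℂ) r, ‖(1 / (z - 0)) ^ k • (z - 0)⁻¹ • gKer σ lam z‖ ≤ r⁻¹ ^ k * r⁻¹ * M := by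
    intro z hz
    have hzr : ‖z‖ = r := by simpa using hz
    rw [norm_smul, norm_smul, sub_zero, norm_pow, norm_div, norm_one, norm_inv, hzr, one_div, mul_assoc]
    exact mul_le_mul_of_nonneg_left (mul_le_mul_of_nonneg_left (norm_gKer_le_of_norm_eq hzr hr1 hlam)
      (inv_nonneg.2 hr0.le)) (pow_nonneg (inv_nonneg.2 hr0.le) _)
  calc ‖(2 * π * I : ℂ)⁻¹ • ∮ z in C(0, r), (1 / (z - 0)) ^ k • (z - 0)⁻¹ • gKer σ lam z‖
      ≤ r * (r⁻¹ ^ k * r⁻¹ * M) := circleIntegral.norm_two_pi_i_inv_smul_integral_le_of_norm_le_const hr0.le hbd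
    _ = M / r ^ k := by
        have hr' : r ≠ 0 := hr0.ne'
        have hrk : r ^ k ≠ 0 := pow_ne_zero _ hr'
        rw [inv_pow, eq_div_iff hrk]
        field_simp

end AriasDeReyna

end Literature.NumberTheory.LFunctions
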